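import Mathlib.Data.Fintype.Perm
import Mathlib.Algebra.BigOperators.Group.Finset.Basic
import Mathlib.GroupTheory.Perm.Basic
import Mathlib.Data.Nat.Factorial.BigOperators
import Mathlib.Data.Fintype.CardEmbedding
import Mathlib.Tactic.Ring
import Mathlib.Tactic.Linarith
import HarnessLib

/-!
# Permutations with prescribed values and permutations avoiding a set

Topic `Literature/Combinatorics/Enumerative`.  Two elementary counts over the symmetric group of
a finite type `α` with `n` elements (the "uniform random permutation" primitives behind the
first-moment method for random lifts, used for the random-graph input of Conneryd–Ghannane–Pang
2025, Theorem 6.1):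

* **`card_perm_prescribed`** — the permutations taking prescribed (injective) values on a set `S`
  of size `s` number `(n - s)!`;
* **`card_perm_avoiding`** — the permutations mapping `S` (size `s`) into the complement of `R`
  (size `r`) number `(n - r)ₛ · (n - s)!` (falling factorial), hence
  **`card_perm_avoiding_mul_le`** — their proportion is at most `((n - r)/n)^s`, i.e.
  `#{σ | σ(S) ∩ R = ∅} · n^s ≤ (n - r)^s · n!`.

Proof of the first count: induction on `S`; the permutations with the values on `S` prescribed
are equidistributed over the `n - s` possible values at a further point (compose with a
transposition of two admissible values), so each fibre has `(n-s)!/(n-s)` elements.  The second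
count is the first one summed over the injections `S ↪ Rᶜ`.

## References

* [folklore] (uniform random permutations; e.g. the random lift model of Amit–Linial).
-/

namespace Literature.Combinatorics.Enumerative

open Finset Equiv

variable {α : Type*} [Fintype α] [DecidableEq α]

/-! ### Prescribed values -/

/-- The permutations agreeing with `f` on `S`. [folklore] -/
def permsPrescribed (S : Finset α) (f : α → α) : Finset (Perm α) :=
  Finset.univ.filter fun σ => ∀ i ∈ S, σ i = f i

/-- Membership in `permsPrescribed`. [folklore] -/
theorem mem_permsPrescribed {S : Finset α} {f : α → α} {σ : Perm α} :
    σ ∈ permsPrescribed S f ↔ ∀ i ∈ S, σ i = f i := by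
  simp [permsPrescribed]

/-- Composing with the transposition of two values NOT taken on `S` preserves the prescription
on `S`. [folklore] -/
theorem swap_mul_mem_permsPrescribed {S : Finset α} {f : α → α} {σ : Perm α}
    (hσ : σ ∈ permsPrescribed S f) {v v' : α} (hv : v ∉ S.image f) (hv' : v' ∉ S.image f) :
    Equiv.swap v v' * σ ∈ permsPrescribed S f := by
  rw [mem_permsPrescribed] at hσ ⊢
  intro i hi
  rw [Perm.mul_apply, hσ i hi]
  apply Equiv.swap_apply_of_ne_of_ne
  · exact fun h => hv (h ▸ Finset.mem_image_of_mem f hi)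
  · exact fun h => hv' (h ▸ Finset.mem_image_of_mem f hi)

/-- **Permutations with prescribed values**: if `f` is injective on `S` then
`#{σ | σ|_S = f|_S} = (n - |S|)!`. [folklore] -/
theorem card_permsPrescribed (S : Finset α) {f : α → α} (hf : Set.InjOn f S) :
    (permsPrescribed S f).card = (Fintype.card α - S.card).factorial := by
  induction S using Finset.induction_on with
  | empty =>
    simp only [permsPrescribed, Finset.notMem_empty, IsEmpty.forall_iff, implies_true,
      Finset.filter_true, Finset.card_univ, Finset.card_empty, Nat.sub_zero]
    exact Fintype.card_perm
  | insert i S hiS ih =>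
    have hfS : Set.InjOn f S := hf.mono (by simp)
    have hcard := ih hfS
    -- the admissible values at `i`
    set T := (Finset.univ : Finset α) \ S.image f with hT
    have hTcard : T.card = Fintype.card α - S.card := by
      rw [hT, Finset.card_sdiff_of_subset (Finset.subset_univ _), Finset.card_univ,
        Finset.card_image_of_injOn hfS]
    have hfi : f i ∈ T := by
      rw [hT, Finset.mem_sdiff]
      refine ⟨Finset.mem_univ _, fun h => ?_⟩
      obtain ⟨j, hj, hji⟩ := Finset.mem_image.1 h
      have : j = i := hf (Finset.mem_insert_of_mem hj) (Finset.mem_insert_self i S) hji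
      exact hiS (this ▸ hj)
    -- every prescribed permutation sends `i` into `T`
    have hmaps : ∀ σ ∈ permsPrescribed S f, σ i ∈ T := by
      intro σ hσ
      rw [hT, Finset.mem_sdiff]
      refine ⟨Finset.mem_univ _, fun h => ?_⟩
      obtain ⟨j, hj, hji⟩ := Finset.mem_image.1 h
      rw [← (mem_permsPrescribed.1 hσ) j hj] at hji
      exact hiS (σ.injective hji ▸ hj)
    -- fibres over `T` are equinumerous
    have hfibre : ∀ v ∈ T, ∀ v' ∈ T,
        ((permsPrescribed S f).filter fun σ => σ i = v).card =
          ((permsPrescribed S f).filter fun σ => σ i = v').card := by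
      intro v hv v' hv'
      have hvS : v ∉ S.image f := (Finset.mem_sdiff.1 hv).2
      have hv'S : v' ∉ S.image f := (Finset.mem_sdiff.1 hv').2
      refine Finset.card_bij (fun σ _ => Equiv.swap v v' * σ) (fun σ hσ => ?_) (fun σ _ σ' _ h => ?_)
        fun σ' hσ' => ?_
      · rw [Finset.mem_filter] at hσ ⊢
        refine ⟨swap_mul_mem_permsPrescribed hσ.1 hvS hv'S, ?_⟩
        rw [Perm.mul_apply, hσ.2, Equiv.swap_apply_left]
      · exact mul_left_cancel h
      · rw [Finset.mem_filter] at hσ'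
        refine ⟨Equiv.swap v v' * σ', ?_, ?_⟩
        · rw [Finset.mem_filter]
          refine ⟨swap_mul_mem_permsPrescribed hσ'.1 hvS hv'S, ?_⟩
          rw [Perm.mul_apply, hσ'.2, Equiv.swap_apply_right]
        · rw [← mul_assoc, Equiv.swap_mul_self, one_mul]
    -- count
    have hsum := Finset.card_eq_sum_card_fiberwise (f := fun σ : Perm α => σ i)
      (s := permsPrescribed S f) (t := T) (fun σ hσ => hmaps σ hσ)
    rw [Finset.sum_congr rfl fun v hv => hfibre v hv (f i) hfi, Finset.sum_const, smul_eq_mul,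
      hcard, hTcard] at hsum
    -- the fibre over `f i` is `permsPrescribed (insert i S) f`
    have hfib : ((permsPrescribed S f).filter fun σ => σ i = f i) = permsPrescribed (insert i S) f := by
      ext σ
      simp only [Finset.mem_filter, mem_permsPrescribed, Finset.mem_insert, forall_eq_or_imp]
      tauto
    rw [hfib] at hsum
    rw [Finset.card_insert_of_notMem hiS]
    -- `(n - s)! = (n - s) * (n - s - 1)!`
    have hpos : 1 ≤ Fintype.card α - S.card := by
      rw [← hTcard]; exact Finset.card_pos.2 ⟨f i, hfi⟩
    have key : (Fintype.card α - S.card).factorial =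
        (Fintype.card α - S.card) * (Fintype.card α - (S.card + 1)).factorial := by
      conv_lhs => rw [show Fintype.card α - S.card = (Fintype.card α - (S.card + 1)) + 1 by omega]
      rw [Nat.factorial_succ]
      congr 1
      omega
    rw [key] at hsum
    exact (Nat.eq_of_mul_eq_mul_left (by omega) hsum).symm

/-! ### Avoiding a set -/

/-- The permutations mapping `S` into the complement of `R`. [folklore] -/
def permsAvoiding (S R : Finset α) : Finset (Perm α) :=
  Finset.univ.filter fun σ => ∀ i ∈ S, σ i ∉ R

/-- Membership in `permsAvoiding`. [folklore] -/
theorem mem_permsAvoiding {S R : Finset α} {σ : Perm α} :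
    σ ∈ permsAvoiding S R ↔ ∀ i ∈ S, σ i ∉ R := by
  simp [permsAvoiding]

/-- **Permutations avoiding a set**: `#{σ | σ(S) ∩ R = ∅} = (n - |R|)_{|S|} · (n - |S|)!`
(sum `card_permsPrescribed` over the injections `S ↪ Rᶜ`). [folklore] -/
theorem card_permsAvoiding (S R : Finset α) :
    (permsAvoiding S R).card =
      (Fintype.card α - R.card).descFactorial S.card * (Fintype.card α - S.card).factorial := by
  classical
  -- restriction to `S`
  let ρ : Perm α → (↥S → α) := fun σ j => σ j
  -- the image: injective maps into `Rᶜ`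
  set I : Finset (↥S → α) := Finset.univ.filter fun τ => Function.Injective τ ∧ ∀ j, τ j ∉ R with hI
  have hmaps : ∀ σ ∈ permsAvoiding S R, ρ σ ∈ I := by
    intro σ hσ
    rw [hI, Finset.mem_filter]
    exact ⟨Finset.mem_univ _, fun j j' h => Subtype.ext (σ.injective h),
      fun j => (mem_permsAvoiding.1 hσ) j j.2⟩
  have hsum := Finset.card_eq_sum_card_fiberwise (f := ρ) (s := permsAvoiding S R) (t := I) hmaps
  -- each fibre is a `permsPrescribed`
  have hfibre : ∀ τ ∈ I, ((permsAvoiding S R).filter fun σ => ρ σ = τ).card =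
      (Fintype.card α - S.card).factorial := by
    intro τ hτ
    obtain ⟨-, hτinj, hτR⟩ := Finset.mem_filter.1 hτ
    -- extend `τ` to `α`
    let f : α → α := fun x => if hx : x ∈ S then τ ⟨x, hx⟩ else x
    have hfS : ∀ x (hx : x ∈ S), f x = τ ⟨x, hx⟩ := fun x hx => dif_pos hx
    have hfinj : Set.InjOn f S := by
      intro x hx y hy hxy
      rw [hfS x hx, hfS y hy] at hxy
      exact congrArg Subtype.val (hτinj hxy)
    have heq : ((permsAvoiding S R).filter fun σ => ρ σ = τ) = permsPrescribed S f := by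
      ext σ
      rw [Finset.mem_filter, mem_permsAvoiding, mem_permsPrescribed]
      constructor
      · rintro ⟨-, hρ⟩ x hx
        rw [hfS x hx, ← hρ]
      · intro h
        refine ⟨fun x hx => ?_, funext fun j => ?_⟩
        · rw [h x hx, hfS x hx]; exact hτR _
        · show σ j = τ j
          rw [h j j.2, hfS j j.2]
    rw [heq, card_permsPrescribed S hfinj]
  rw [Finset.sum_congr rfl hfibre, Finset.sum_const, smul_eq_mul] at hsum
  rw [hsum]
  congr 1
  -- `#I` = number of embeddings `S ↪ Rᶜ`
  have hIcard : I.card = Fintype.card (↥S ↪ {x // x ∉ R}) := by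
    refine Finset.card_bij (fun τ hτ => ⟨fun j => ⟨τ j, (Finset.mem_filter.1 hτ).2.2 j⟩,
      fun j j' h => (Finset.mem_filter.1 hτ).2.1 (congrArg Subtype.val h)⟩) (fun _ _ => Finset.mem_univ _)
      (fun τ hτ τ' hτ' h => ?_) fun e _ => ?_
    · funext j
      exact congrArg Subtype.val (congrFun (congrArg (fun (e : ↥S ↪ {x // x ∉ R}) => ⇑e) h) j)
    · refine ⟨fun j => (e j).1, Finset.mem_filter.2 ⟨Finset.mem_univ _, fun j j' h => e.injective
        (Subtype.ext h), fun j => (e j).2⟩, ?_⟩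
      ext j; rfl
  rw [hIcard, Fintype.card_embedding_eq, Fintype.card_coe]
  congr 1
  rw [Fintype.card_subtype_compl, Fintype.card_coe]

/-- **The avoidance probability bound**: `#{σ | σ(S) ∩ R = ∅} · n^{|S|} ≤ (n - |R|)^{|S|} · n!`, i.e.
the proportion of permutations mapping `S` into `Rᶜ` is at most `((n-|R|)/n)^{|S|}`.
[folklore] -/
theorem card_permsAvoiding_mul_le (S R : Finset α) :
    (permsAvoiding S R).card * Fintype.card α ^ S.card ≤
      (Fintype.card α - R.card) ^ S.card * (Fintype.card α).factorial := by
  rw [card_permsAvoiding]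
  set n := Fintype.card α with hn
  set s := S.card
  set r := R.card
  by_cases hs : s ≤ n
  swap
  · have : (n - r).descFactorial s = 0 := Nat.descFactorial_eq_zero_iff_lt.2 (by omega)
    rw [this]; simp
  -- `n! = n_(s) * (n - s)!`
  have hfact : n.factorial = n.descFactorial s * (n - s).factorial := by
    rw [← Nat.factorial_mul_descFactorial hs, mul_comm]
  rw [hfact]
  -- `(n-r)_(s) * n^s ≤ (n-r)^s * n_(s)`: termwise `(n - r - i) * n ≤ (n - r) * (n - i)`
  suffices h : (n - r).descFactorial s * n ^ s ≤ (n - r) ^ s * n.descFactorial s by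
    calc (n - r).descFactorial s * (n - s).factorial * n ^ s
        = (n - r).descFactorial s * n ^ s * (n - s).factorial := by ring
      _ ≤ (n - r) ^ s * n.descFactorial s * (n - s).factorial := Nat.mul_le_mul_right _ h
      _ = (n - r) ^ s * (n.descFactorial s * (n - s).factorial) := by ring
  rw [Nat.descFactorial_eq_prod_range, Nat.descFactorial_eq_prod_range,
    show n ^ s = ∏ _i ∈ Finset.range s, n by rw [Finset.prod_const, Finset.card_range],
    show (n - r) ^ s = ∏ _i ∈ Finset.range s, (n - r) by rw [Finset.prod_const, Finset.card_range],
    ← Finset.prod_mul_distrib, ← Finset.prod_mul_distrib]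
  refine Finset.prod_le_prod' fun i hi => ?_
  have hi : i < s := Finset.mem_range.1 hi
  -- `(n - r - i) * n ≤ (n - r) * (n - i)`
  rcases Nat.lt_or_ge (n - r) i with h | h
  · rw [Nat.sub_eq_zero_of_le (le_of_lt h), zero_mul]; exact Nat.zero_le _
  · have h1 : n - r - i + i = n - r := Nat.sub_add_cancel h
    have h2 : i ≤ n := by omega
    nlinarith [Nat.sub_add_cancel h2, Nat.zero_le (r * i), Nat.sub_le n r]

end Literature.Combinatorics.Enumerative
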